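import Literature.Analysis.Calculus.GlaeserTorusLocal

/-!
# Glaeser on the torus with parameters, local form — places indexed by an arbitrary finite type

Transport of ★ `exists_contDiff_comp_classPi_near` (places `Fin m`) along `Fintype.equivFin D` to an arbitrary finite index
type `D` of places (e.g. the complex places of a CM field): a smooth `f : (D → Fin 3 → ℝ) × P → E`, invariant at every place
under the slot permutations and the `2πℤ³`-shifts of the three angles, factors near every point through the place-wise class
data `cl x = (w ↦ (Σ_k e^{ix_w k}, Σ_{j<k} e^{ix_w j}e^{ix_w k}, Π_k e^{ix_w k}))` by an everywhere-smooth `F`.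
[Glaeser1963Newton, Thm. II], [Schwarz1975, Thm. 1].
-/

noncomputable section

open Complex Set
open scoped ContDiff Topology

namespace Literature.Analysis.Calculus

/-! ## §1 Reindexing is an isometry for the sup distance -/

/-- The sup distance is invariant under reindexing along an equivalence. [cite: Dieudonne1960, Ch. III §20] -/
theorem dist_comp_equiv_eq {ι κ : Type*} [Fintype ι] [Fintype κ] {X : Type*} [PseudoMetricSpace X] (e : ι ≃ κ) (u v : κ → X) :
    dist (u ∘ e) (v ∘ e) = dist u v := by
  refine le_antisymm ((dist_pi_le_iff dist_nonneg).2 fun i => dist_le_pi_dist u v (e i)) ((dist_pi_le_iff dist_nonneg).2 fun j => ?_)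
  have h := dist_le_pi_dist (u ∘ e) (v ∘ e) (e.symm j)
  simpa using h

/-! ## §2 The local theorem over a finite index type of places -/

universe u

variable {P : Type u} [NormedAddCommGroup P] [NormedSpace ℝ P] [FiniteDimensional ℝ P] {E : Type u} [NormedAddCommGroup E] [NormedSpace ℝ E] [CompleteSpace E]

/-- **GLAESER ON THE TORUS WITH PARAMETERS — LOCAL FORM, PLACES INDEXED BY A FINITE TYPE `D`.**  `f : (D → Fin 3 → ℝ) × P → E` smooth, invariant at every place under
the slot permutations and the `2πℤ³`-shifts; then for every `x₀` there are `ε > 0` and **`F : (D → ℂ × ℂ × ℂ) × P → E`, `C^∞` everywhere, with `f (x, z) = F (cl x, z)`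
whenever `dist (cl x) (cl x₀) < ε`** (transport of ★ `exists_contDiff_comp_classPi_near` along `Fintype.equivFin D`). [cite: Glaeser1963Newton, Thm. II] [cite: Schwarz1975, Thm. 1] -/
theorem exists_contDiff_comp_classFun_near {D : Type} [Fintype D] [DecidableEq D] (f : (D → Fin 3 → ℝ) × P → E) (hf : ContDiff ℝ ∞ f)
    (hsymm : ∀ (w : D) (σ : Equiv.Perm (Fin 3)) (x : D → Fin 3 → ℝ) (z : P), f (Function.update x w (x w ∘ (⇑σ)), z) = f (x, z))
    (hper : ∀ (w : D) (n : Fin 3 → ℤ) (x : D → Fin 3 → ℝ) (z : P),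
      f (Function.update x w (x w + fun k => 2 * Real.pi * (n k : ℝ)), z) = f (x, z))
    (x₀ : D → Fin 3 → ℝ) :
    ∃ ε > (0 : ℝ), ∃ F : (D → ℂ × ℂ × ℂ) × P → E, ContDiff ℝ ∞ F ∧
      ∀ (x : D → Fin 3 → ℝ) (z : P), dist (fun w => ((Complex.exp ((((x w 0 : ℝ)) : ℂ) * I) + Complex.exp ((((x w 1 : ℝ)) : ℂ) * I) + Complex.exp ((((x w 2 : ℝ)) : ℂ) * I),
          Complex.exp ((((x w 0 : ℝ)) : ℂ) * I) * Complex.exp ((((x w 1 : ℝ)) : ℂ) * I) + Complex.exp ((((x w 0 : ℝ)) : ℂ) * I) * Complex.exp ((((x w 2 : ℝ)) : ℂ) * I) + Complex.exp ((((x w 1 : ℝ)) : ℂ) * I) * Complex.exp ((((x w 2 : ℝ)) : ℂ) * I),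
          Complex.exp ((((x w 0 : ℝ)) : ℂ) * I) * Complex.exp ((((x w 1 : ℝ)) : ℂ) * I) * Complex.exp ((((x w 2 : ℝ)) : ℂ) * I)) : ℂ × ℂ × ℂ)) (fun w => ((Complex.exp ((((x₀ w 0 : ℝ)) : ℂ) * I) + Complex.exp ((((x₀ w 1 : ℝ)) : ℂ) * I) + Complex.exp ((((x₀ w 2 : ℝ)) : ℂ) * I),
          Complex.exp ((((x₀ w 0 : ℝ)) : ℂ) * I) * Complex.exp ((((x₀ w 1 : ℝ)) : ℂ) * I) + Complex.exp ((((x₀ w 0 : ℝ)) : ℂ) * I) * Complex.exp ((((x₀ w 2 : ℝ)) : ℂ) * I) + Complex.exp ((((x₀ w 1 : ℝ)) : ℂ) * I) * Complex.exp ((((x₀ w 2 : ℝ)) : ℂ) * I),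
          Complex.exp ((((x₀ w 0 : ℝ)) : ℂ) * I) * Complex.exp ((((x₀ w 1 : ℝ)) : ℂ) * I) * Complex.exp ((((x₀ w 2 : ℝ)) : ℂ) * I)) : ℂ × ℂ × ℂ)) < ε → f (x, z) = F ((fun w => ((Complex.exp ((((x w 0 : ℝ)) : ℂ) * I) + Complex.exp ((((x w 1 : ℝ)) : ℂ) * I) + Complex.exp ((((x w 2 : ℝ)) : ℂ) * I),
          Complex.exp ((((x w 0 : ℝ)) : ℂ) * I) * Complex.exp ((((x w 1 : ℝ)) : ℂ) * I) + Complex.exp ((((x w 0 : ℝ)) : ℂ) * I) * Complex.exp ((((x w 2 : ℝ)) : ℂ) * I) + Complex.exp ((((x w 1 : ℝ)) : ℂ) * I) * Complex.exp ((((x w 2 : ℝ)) : ℂ) * I),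
          Complex.exp ((((x w 0 : ℝ)) : ℂ) * I) * Complex.exp ((((x w 1 : ℝ)) : ℂ) * I) * Complex.exp ((((x w 2 : ℝ)) : ℂ) * I)) : ℂ × ℂ × ℂ)), z) := by
  set cl : (D → Fin 3 → ℝ) → (D → ℂ × ℂ × ℂ) := fun x => (fun w => ((Complex.exp ((((x w 0 : ℝ)) : ℂ) * I) + Complex.exp ((((x w 1 : ℝ)) : ℂ) * I) + Complex.exp ((((x w 2 : ℝ)) : ℂ) * I),
          Complex.exp ((((x w 0 : ℝ)) : ℂ) * I) * Complex.exp ((((x w 1 : ℝ)) : ℂ) * I) + Complex.exp ((((x w 0 : ℝ)) : ℂ) * I) * Complex.exp ((((x w 2 : ℝ)) : ℂ) * I) + Complex.exp ((((x w 1 : ℝ)) : ℂ) * I) * Complex.exp ((((x w 2 : ℝ)) : ℂ) * I),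
          Complex.exp ((((x w 0 : ℝ)) : ℂ) * I) * Complex.exp ((((x w 1 : ℝ)) : ℂ) * I) * Complex.exp ((((x w 2 : ℝ)) : ℂ) * I)) : ℂ × ℂ × ℂ)) with hcl
  show ∃ ε > (0 : ℝ), ∃ F : (D → ℂ × ℂ × ℂ) × P → E, ContDiff ℝ ∞ F ∧ ∀ (x : D → Fin 3 → ℝ) (z : P), dist (cl x) (cl x₀) < ε → f (x, z) = F (cl x, z)
  set m : ℕ := Fintype.card D with hm
  set e : D ≃ Fin m := Fintype.equivFin D with he
  set clm : (Fin m → Fin 3 → ℝ) → (Fin m → ℂ × ℂ × ℂ) := fun x' => (fun w => ((Complex.exp ((((x' w 0 : ℝ)) : ℂ) * I) + Complex.exp ((((x' w 1 : ℝ)) : ℂ) * I) + Complex.exp ((((x' w 2 : ℝ)) : ℂ) * I),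
          Complex.exp ((((x' w 0 : ℝ)) : ℂ) * I) * Complex.exp ((((x' w 1 : ℝ)) : ℂ) * I) + Complex.exp ((((x' w 0 : ℝ)) : ℂ) * I) * Complex.exp ((((x' w 2 : ℝ)) : ℂ) * I) + Complex.exp ((((x' w 1 : ℝ)) : ℂ) * I) * Complex.exp ((((x' w 2 : ℝ)) : ℂ) * I),
          Complex.exp ((((x' w 0 : ℝ)) : ℂ) * I) * Complex.exp ((((x' w 1 : ℝ)) : ℂ) * I) * Complex.exp ((((x' w 2 : ℝ)) : ℂ) * I)) : ℂ × ℂ × ℂ)) with hclm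
  -- the transported function
  set f' : (Fin m → Fin 3 → ℝ) × P → E := fun q => f (q.1 ∘ (⇑e), q.2) with hf'
  have hre : ContDiff ℝ ∞ fun x' : Fin m → Fin 3 → ℝ => (x' ∘ (⇑e) : D → Fin 3 → ℝ) := contDiff_pi.2 fun w => contDiff_apply ℝ (Fin 3 → ℝ) (e w)
  have hf's : ContDiff ℝ ∞ f' := hf.comp ((hre.comp contDiff_fst).prodMk contDiff_snd)
  have hsymm' : ∀ (i : Fin m) (σ : Equiv.Perm (Fin 3)) (x' : Fin m → Fin 3 → ℝ) (z : P),
      f' (Function.update x' i (x' i ∘ (⇑σ)), z) = f' (x', z) := by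
    intro i σ x' z
    simp only [hf']
    rw [Function.update_comp_equiv]
    have h := hsymm (e.symm i) σ (x' ∘ (⇑e)) z
    rw [Function.comp_apply, Equiv.apply_symm_apply] at h
    exact h
  have hper' : ∀ (i : Fin m) (n : Fin 3 → ℤ) (x' : Fin m → Fin 3 → ℝ) (z : P),
      f' (Function.update x' i (x' i + fun k => 2 * Real.pi * (n k : ℝ)), z) = f' (x', z) := by
    intro i n x' z
    simp only [hf']
    rw [Function.update_comp_equiv]
    have h := hper (e.symm i) n (x' ∘ (⇑e)) z
    rw [Function.comp_apply, Equiv.apply_symm_apply] at h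
    exact h
  obtain ⟨ε, hε, F', hF's, h'⟩ := exists_contDiff_comp_classPi_near f' hf's hsymm' hper' (x₀ ∘ (⇑e.symm))
  have hclm : ∀ x : D → Fin 3 → ℝ, clm (x ∘ (⇑e.symm)) = cl x ∘ (⇑e.symm) := fun x => rfl
  have hreC : ContDiff ℝ ∞ fun s : D → ℂ × ℂ × ℂ => (s ∘ (⇑e.symm) : Fin m → ℂ × ℂ × ℂ) :=
    contDiff_pi.2 fun i => contDiff_apply ℝ (ℂ × ℂ × ℂ) (e.symm i)
  refine ⟨ε, hε, fun q => F' (q.1 ∘ (⇑e.symm), q.2), hF's.comp ((hreC.comp contDiff_fst).prodMk contDiff_snd), fun x z hx => ?_⟩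
  have hx' : dist (clm (x ∘ (⇑e.symm))) (clm (x₀ ∘ (⇑e.symm))) < ε := by
    rw [hclm, hclm, dist_comp_equiv_eq]; exact hx
  have h := h' (x ∘ (⇑e.symm)) z hx'
  simp only [hf'] at h
  have hxx : (x ∘ (⇑e.symm)) ∘ (⇑e) = x := by funext w; simp
  rw [hxx] at h
  rw [h]
  rfl

/-! ## §3 The same, with the base point given by its class data in the class image `K^D` -/

/-- **LOCAL GLAESER ON THE TORUS, BASE POINT IN THE CLASS IMAGE** — the shape consumed by the endoscopic assembly: for every `b : D → ℂ³` with each `b w` in the class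
image `K = {(Σ e^{it_k}, Σ_{j<k} e^{it_j}e^{it_k}, Π e^{it_k})}` there are `ε > 0` and an everywhere-smooth `F` with `f (x, z) = F (cl x, z)` whenever `dist (cl_w x) (b w) < ε` at every
place `w` (★ `exists_contDiff_comp_classFun_near` at any angle lift `x₀` of `b`). [cite: Glaeser1963Newton, Thm. II] [cite: Schwarz1975, Thm. 1] -/
theorem exists_contDiff_comp_classFun_near_of_mem_range {D : Type} [Fintype D] [DecidableEq D] (f : (D → Fin 3 → ℝ) × P → E) (hf : ContDiff ℝ ∞ f)
    (hsymm : ∀ (w : D) (σ : Equiv.Perm (Fin 3)) (x : D → Fin 3 → ℝ) (z : P), f (Function.update x w (x w ∘ (⇑σ)), z) = f (x, z))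
    (hper : ∀ (w : D) (n : Fin 3 → ℤ) (x : D → Fin 3 → ℝ) (z : P),
      f (Function.update x w (x w + fun k => 2 * Real.pi * (n k : ℝ)), z) = f (x, z))
    (b : D → ℂ × ℂ × ℂ) (hb : ∀ w, b w ∈ Set.range fun t : Fin 3 → ℝ => ((Complex.exp ((((t 0 : ℝ)) : ℂ) * I) + Complex.exp ((((t 1 : ℝ)) : ℂ) * I) + Complex.exp ((((t 2 : ℝ)) : ℂ) * I),
          Complex.exp ((((t 0 : ℝ)) : ℂ) * I) * Complex.exp ((((t 1 : ℝ)) : ℂ) * I) + Complex.exp ((((t 0 : ℝ)) : ℂ) * I) * Complex.exp ((((t 2 : ℝ)) : ℂ) * I) + Complex.exp ((((t 1 : ℝ)) : ℂ) * I) * Complex.exp ((((t 2 : ℝ)) : ℂ) * I),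
          Complex.exp ((((t 0 : ℝ)) : ℂ) * I) * Complex.exp ((((t 1 : ℝ)) : ℂ) * I) * Complex.exp ((((t 2 : ℝ)) : ℂ) * I)) : ℂ × ℂ × ℂ)) :
    ∃ ε > (0 : ℝ), ∃ F : (D → ℂ × ℂ × ℂ) × P → E, ContDiff ℝ ∞ F ∧
      ∀ (x : D → Fin 3 → ℝ) (z : P), (∀ w, dist ((Complex.exp ((((x w 0 : ℝ)) : ℂ) * I) + Complex.exp ((((x w 1 : ℝ)) : ℂ) * I) + Complex.exp ((((x w 2 : ℝ)) : ℂ) * I),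
          Complex.exp ((((x w 0 : ℝ)) : ℂ) * I) * Complex.exp ((((x w 1 : ℝ)) : ℂ) * I) + Complex.exp ((((x w 0 : ℝ)) : ℂ) * I) * Complex.exp ((((x w 2 : ℝ)) : ℂ) * I) + Complex.exp ((((x w 1 : ℝ)) : ℂ) * I) * Complex.exp ((((x w 2 : ℝ)) : ℂ) * I),
          Complex.exp ((((x w 0 : ℝ)) : ℂ) * I) * Complex.exp ((((x w 1 : ℝ)) : ℂ) * I) * Complex.exp ((((x w 2 : ℝ)) : ℂ) * I)) : ℂ × ℂ × ℂ) (b w) < ε) → f (x, z) = F ((fun w => ((Complex.exp ((((x w 0 : ℝ)) : ℂ) * I) + Complex.exp ((((x w 1 : ℝ)) : ℂ) * I) + Complex.exp ((((x w 2 : ℝ)) : ℂ) * I),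
          Complex.exp ((((x w 0 : ℝ)) : ℂ) * I) * Complex.exp ((((x w 1 : ℝ)) : ℂ) * I) + Complex.exp ((((x w 0 : ℝ)) : ℂ) * I) * Complex.exp ((((x w 2 : ℝ)) : ℂ) * I) + Complex.exp ((((x w 1 : ℝ)) : ℂ) * I) * Complex.exp ((((x w 2 : ℝ)) : ℂ) * I),
          Complex.exp ((((x w 0 : ℝ)) : ℂ) * I) * Complex.exp ((((x w 1 : ℝ)) : ℂ) * I) * Complex.exp ((((x w 2 : ℝ)) : ℂ) * I)) : ℂ × ℂ × ℂ)), z) := by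
  choose x₀ hx₀ using hb
  obtain ⟨ε, hε, F, hF, h⟩ := exists_contDiff_comp_classFun_near f hf hsymm hper x₀
  refine ⟨ε, hε, F, hF, fun x z hx => h x z ((dist_pi_lt_iff hε).2 fun w => ?_)⟩
  have hw : ((Complex.exp ((((x₀ w 0 : ℝ)) : ℂ) * I) + Complex.exp ((((x₀ w 1 : ℝ)) : ℂ) * I) + Complex.exp ((((x₀ w 2 : ℝ)) : ℂ) * I),
          Complex.exp ((((x₀ w 0 : ℝ)) : ℂ) * I) * Complex.exp ((((x₀ w 1 : ℝ)) : ℂ) * I) + Complex.exp ((((x₀ w 0 : ℝ)) : ℂ) * I) * Complex.exp ((((x₀ w 2 : ℝ)) : ℂ) * I) + Complex.exp ((((x₀ w 1 : ℝ)) : ℂ) * I) * Complex.exp ((((x₀ w 2 : ℝ)) : ℂ) * I),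
          Complex.exp ((((x₀ w 0 : ℝ)) : ℂ) * I) * Complex.exp ((((x₀ w 1 : ℝ)) : ℂ) * I) * Complex.exp ((((x₀ w 2 : ℝ)) : ℂ) * I)) : ℂ × ℂ × ℂ) = b w := hx₀ w
  rw [hw]
  exact hx w

end Literature.Analysis.Calculus

end
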